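import Mathlib
import HarnessLib
import Literature.Probability.TransportMaps.TopologicalSupportObstruction
import Literature.Probability.TransportMaps.BiLipschitzWeakLimit

/-!
# Pushforwards of a fixed law can converge weakly to a law with non-homeomorphic support only if
# their bi-Lipschitz constants blow up (Cornish–Caterini–Deligiannidis–Doucet 2020, Theorem 2.1 and
# Corollary 2.2)

Companion of `TopologicalSupportObstruction.lean` (same directory), which types the setting
[cite: CornishEtAl2020, §2], Props. B.3/B.4/B.6 of the Supplement and Theorem 2.1 in the
exact-transport case.  This file proves the theorem AS PRINTED, for a sequence of maps and weak
convergence, and its `ε`-version Corollary 2.2.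

* **`CornishEtAl2020_thm_2_1`** [cite: CornishEtAl2020, Thm 2.1]: "Suppose `P_Z` and `P_X⋆` are
  probability measures on `ℝ^{d_𝒵}` and `ℝ^{d_𝒳}` respectively, and that `supp P_Z ≇ supp P_X⋆`.
  Then for any sequence of measurable `f_n : ℝ^{d_𝒵} → ℝ^{d_𝒳}`, we can have `f_n # P_Z ⇒ P_X⋆`
  only if `lim_{n→∞} BiLip f_n = ∞`."  Weak convergence `⇒` is convergence in Mathlib's topology
  on `ProbabilityMeasure` (of the pushforwards `ProbabilityMeasure.map`); the conclusion is typed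
  as `∀ M, ∀ᶠ n, ¬ (LipschitzWith M (f n) ∧ AntilipschitzWith M (f n))` (`BiLip f_n > M`
  eventually, for every `M`).  The general form `eventually_not_biLipschitz_of_tendsto` /
  `nonempty_homeomorph_support_of_tendsto` holds for a complete separable metric space `𝒵` and a
  proper metric space `𝒳`, with weak convergence written through integrals of bounded continuous
  functions.
* **`CornishEtAl2020_cor_2_2`** [cite: CornishEtAl2020, Cor. 2.2]: "Suppose `P_Z` and `P⁰_X` are
  probability measures on `ℝ^{d_𝒵}` and `ℝ^{d_𝒳}` respectively with `supp P_Z ≇ supp P⁰_X`.  Then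
  there exists nonincreasing `L : [0, ∞) → [1, ∞]` with `L(ε) → ∞` as `ε → 0` such that, for any
  probability measure `P_X⋆` on `ℝ^{d_𝒳}`, we have `BiLip f ≥ L(ε)` whenever `ρ(P_X⋆, P⁰_X) ≤ ε`
  and `ρ(f # P_Z, P_X⋆) ≤ ε`", `ρ` being "any metric for the weak topology".  Typed with `ρ` an
  arbitrary nonnegative function on pairs of probability measures satisfying the triangle
  inequality and "`ρ(P_n, P) → 0 ⇒ P_n ⇒ P`" (the two properties the printed proof uses; the
  Lévy–Prokhorov and bounded-Lipschitz metrics qualify), `L : ℝ → ℝ≥0∞` antitone with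
  `L → ⊤` along `𝓝[>] 0`, and "`BiLip f ≥ L(ε)`" as `L ε ≤ M` for every `M` that is both a
  Lipschitz and an antilipschitz constant of `f`; the `ε`–`M` form without `L` is
  `CornishEtAl2020_cor_2_2_eps`.

Proof architecture = the printed one [cite: CornishEtAl2020, Supplement §B.3]; steps (1)–(4) live
in `BiLipschitzWeakLimit.lean` (same directory; `exists_biLipschitz_map_eq_of_tendsto`), with
three Mathlib-side shortcuts said there: (1) pointwise boundedness of `(f_n)` —
`exists_forall_dist_apply_le` (printed: Prokhorov tightness; here: two large balls and a bump
function tested against the weak convergence); (2) a subsequence converging pointwise —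
`exists_subseq_tendsto_on_seq` + `exists_tendsto_of_tendsto_dense` (printed: Arzelà–Ascoli,
Thm B.9; here: sequential compactness of a countable product of closed balls of the proper space
`𝒳`, then the equi-Lipschitz `ε/3` argument from a dense sequence); (3) the limit `f_∞` is
bi-Lipschitz with the same constant — `lipschitzWith_of_tendsto`, `antilipschitzWith_of_tendsto`;
(4) `f_{n'} # P_Z ⇒ f_∞ # P_Z`, hence `f_∞ # P_Z = P_X⋆` — `map_eq_of_tendsto_pointwise` (printed:
Portmanteau with uniform convergence on compacts; here: dominated convergence from pointwise
convergence, and uniqueness `ext_of_forall_integral_eq_of_IsFiniteMeasure`); (5) `f_∞` is a closed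
embedding, so `supp P_X⋆ = f_∞(supp P_Z) ≅ supp P_Z` — the companion file's
`nonempty_homeomorph_support_map` (Props. B.3, B.4, B.6).

Deliberately NOT here: a `BiLip` functional (the statements quantify over admissible constants
`M` instead); metrisability of the weak topology (the corollary is stated for any `ρ` with the two
used properties); §3 ff. of the paper.
-/

namespace Literature.Probability.TransportMaps

open _root_.MeasureTheory Set Filter Topology Metric BoundedContinuousFunction
open scoped _root_.Topology NNReal ENNReal

variable {Z X : Type*}

section Main

variable [MetricSpace Z] [MeasurableSpace Z] [BorelSpace Z]
  [MetricSpace X] [MeasurableSpace X] [BorelSpace X]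

/-! ## Theorem 2.1 in contrapositive form with a uniform bi-Lipschitz bound
(the last step of the printed proof; Steps 1–4 are `BiLipschitzWeakLimit.lean`) -/

/-- **Theorem 2.1, core** [cite: CornishEtAl2020, Thm 2.1; Supplement §B.3]: on a complete separable
metric space `𝒵` and a proper metric space `𝒳`, if probability measures satisfy `f_n # μ ⇒ ν`
weakly for a sequence of maps that are all `M`-Lipschitz and `M`-antilipschitz (a uniform bound
`BiLip f_n ≤ M`), then `supp μ ≅ supp ν`.  The printed architecture: pointwise boundedness
(Step 1), a convergent subsequence (Steps 2–3, Arzelà–Ascoli), the limit `f_∞` is bi-Lipschitz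
(Step 3), `f_∞ # μ = ν` (Step 4) — these four are `exists_biLipschitz_map_eq_of_tendsto` of
`BiLipschitzWeakLimit.lean` — and finally `supp ν = f_∞(supp μ) ≅ supp μ` (Props. B.3, B.4, B.6,
`TopologicalSupportObstruction.nonempty_homeomorph_support_map`). -/
theorem nonempty_homeomorph_support_of_tendsto [CompleteSpace Z] [SecondCountableTopology Z]
    [ProperSpace X] {μ : Measure Z} [IsProbabilityMeasure μ] {ν : Measure X}
    [IsProbabilityMeasure ν] {f : ℕ → Z → X} {M : ℝ≥0}
    (hl : ∀ n, LipschitzWith M (f n)) (ha : ∀ n, AntilipschitzWith M (f n))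
    (hint : ∀ h : X →ᵇ ℝ, Tendsto (fun n => ∫ z, h (f n z) ∂μ) atTop (𝓝 (∫ x, h x ∂ν))) :
    Nonempty (μ.support ≃ₜ ν.support) := by
  obtain ⟨g, hgl, hga, hmap⟩ := exists_biLipschitz_map_eq_of_tendsto hl ha hint
  -- `g` is a closed embedding (Props. B.5–B.6), so `supp ν = g (supp μ) ≅ supp μ` (Props. B.3–B.4)
  have hce : IsClosedEmbedding g := hga.isClosedEmbedding hgl.uniformContinuous
  rw [← hmap]
  exact nonempty_homeomorph_support_map Measure.measure_compl_support hce hgl.continuous.measurable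

/-- **Theorem 2.1, "`lim BiLip f_n = ∞`" form, general metric spaces** [cite: CornishEtAl2020,
Thm 2.1]: if `supp μ ≇ supp ν` and `f_n # μ ⇒ ν` weakly, then for every `M` eventually NO `f_n` is
both `M`-Lipschitz and `M`-antilipschitz, i.e. `BiLip f_n → ∞`.  (From the core by passing to the
subsequence along which `BiLip f_n ≤ M`, which still has `f_n # μ ⇒ ν`.) -/
theorem eventually_not_biLipschitz_of_tendsto [CompleteSpace Z] [SecondCountableTopology Z]
    [ProperSpace X] {μ : Measure Z} [IsProbabilityMeasure μ] {ν : Measure X}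
    [IsProbabilityMeasure ν] (hsupp : IsEmpty (μ.support ≃ₜ ν.support)) {f : ℕ → Z → X}
    (hint : ∀ h : X →ᵇ ℝ, Tendsto (fun n => ∫ z, h (f n z) ∂μ) atTop (𝓝 (∫ x, h x ∂ν)))
    (M : ℝ≥0) : ∀ᶠ n in atTop, ¬ (LipschitzWith M (f n) ∧ AntilipschitzWith M (f n)) := by
  by_contra hne
  rw [not_eventually] at hne
  simp only [not_not] at hne
  obtain ⟨φ, hφ, hP⟩ := extraction_of_frequently_atTop hne
  have hint' : ∀ h : X →ᵇ ℝ,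
      Tendsto (fun n => ∫ z, h (f (φ n) z) ∂μ) atTop (𝓝 (∫ x, h x ∂ν)) :=
    fun h => (hint h).comp hφ.tendsto_atTop
  obtain ⟨e⟩ := nonempty_homeomorph_support_of_tendsto (f := fun n => f (φ n))
    (fun n => (hP n).1) (fun n => (hP n).2) hint'
  exact hsupp.false e

/-! ## Corollary 2.2: the `ε`-version for a weak metric `ρ` -/

/-- **Corollary 2.2, `ε`–`M` form, general metric spaces** [cite: CornishEtAl2020, Cor. 2.2 and
its proof, Supplement §B.3]: if `supp P_Z ≇ supp P⁰` then for every `M` there is `ε > 0` such that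
no `M`-bi-Lipschitz `f` has `ρ(f # P_Z, P_X⋆) ≤ ε` for a law `P_X⋆` with `ρ(P_X⋆, P⁰) ≤ ε`.  Here
`ρ` is any nonnegative function satisfying the triangle inequality and detecting weak convergence
(`ρ(P_n, P) → 0 ⇒ P_n ⇒ P`).  Proof as printed: otherwise `ε_n = 1/(n+1)` yields `f_n` with
`ρ(f_n # P_Z, P⁰) ≤ 2ε_n → 0`, so `f_n # P_Z ⇒ P⁰` with `BiLip f_n ≤ M`, contradicting
Theorem 2.1. -/
theorem CornishEtAl2020_cor_2_2_eps [CompleteSpace Z] [SecondCountableTopology Z] [ProperSpace X]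
    (P_Z : ProbabilityMeasure Z) (P₀ : ProbabilityMeasure X)
    (hsupp : IsEmpty ((P_Z : Measure Z).support ≃ₜ (P₀ : Measure X).support))
    (ρ : ProbabilityMeasure X → ProbabilityMeasure X → ℝ) (hρ0 : ∀ P Q, 0 ≤ ρ P Q)
    (hρt : ∀ P Q R, ρ P R ≤ ρ P Q + ρ Q R)
    (hρw : ∀ (s : ℕ → ProbabilityMeasure X) (P : ProbabilityMeasure X),
      Tendsto (fun n => ρ (s n) P) atTop (𝓝 0) → Tendsto s atTop (𝓝 P))
    (M : ℝ≥0) :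
    ∃ ε : ℝ, 0 < ε ∧ ∀ (P_X : ProbabilityMeasure X) (f : Z → X)
      (hf : AEMeasurable f (P_Z : Measure Z)), ρ P_X P₀ ≤ ε → ρ (P_Z.map hf) P_X ≤ ε →
      ¬ (LipschitzWith M f ∧ AntilipschitzWith M f) := by
  by_contra hne
  push Not at hne
  -- for `ε = 1/(n+1)` pick offending `P_n`, `f_n`
  choose P f hf hP hfP hbi using fun n : ℕ => hne (1 / ((n : ℝ) + 1)) (by positivity)
  -- `ρ(f_n # P_Z, P₀) ≤ 2/(n+1) → 0`
  have hρle : ∀ n, ρ (P_Z.map (hf n)) P₀ ≤ 2 / ((n : ℝ) + 1) := fun n =>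
    calc ρ (P_Z.map (hf n)) P₀ ≤ ρ (P_Z.map (hf n)) (P n) + ρ (P n) P₀ := hρt _ _ _
      _ ≤ 1 / ((n : ℝ) + 1) + 1 / ((n : ℝ) + 1) := add_le_add (hfP n) (hP n)
      _ = 2 / ((n : ℝ) + 1) := by ring
  have hlim2 : Tendsto (fun n : ℕ => 2 / ((n : ℝ) + 1)) atTop (𝓝 0) := by
    have h2 : (fun n : ℕ => 2 / ((n : ℝ) + 1)) = fun n : ℕ => 2 * (1 / ((n : ℝ) + 1)) := by
      funext n; ring
    rw [h2]
    simpa using (tendsto_one_div_add_atTop_nhds_zero_nat).const_mul (2 : ℝ)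
  have hρlim : Tendsto (fun n => ρ (P_Z.map (hf n)) P₀) atTop (𝓝 0) :=
    squeeze_zero (fun n => hρ0 _ _) hρle hlim2
  have hconv : Tendsto (fun n => P_Z.map (hf n)) atTop (𝓝 P₀) :=
    hρw (fun n => P_Z.map (hf n)) P₀ hρlim
  -- weak convergence in integral form
  have hint : ∀ h : X →ᵇ ℝ, Tendsto (fun n => ∫ z, h (f n z) ∂(P_Z : Measure Z)) atTop
      (𝓝 (∫ x, h x ∂(P₀ : Measure X))) := by
    intro h
    have := (ProbabilityMeasure.tendsto_iff_forall_integral_tendsto.1 hconv) h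
    refine this.congr' (Eventually.of_forall fun n => ?_)
    rw [ProbabilityMeasure.toMeasure_map, integral_map (hf n) h.continuous.aestronglyMeasurable]
  obtain ⟨e⟩ := nonempty_homeomorph_support_of_tendsto (fun n => (hbi n).1) (fun n => (hbi n).2)
    hint
  exact hsupp.false e

/-- **Corollary 2.2, general metric spaces, with the printed function `L`**
[cite: CornishEtAl2020, Cor. 2.2]: there is an antitone `L : ℝ → [0, ∞]` with `L(ε) → ∞` as
`ε → 0⁺` such that `L(ε) ≤ BiLip f` (i.e. `L ε ≤ M` for every admissible constant `M` of `f`)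
whenever `ρ(P_X⋆, P⁰) ≤ ε` and `ρ(f # P_Z, P_X⋆) ≤ ε`.  As in the printed proof, `L(ε)` is the
infimum of the admissible constants over all such `f` (the paper's codomain `[1, ∞]` is immaterial
and not enforced). -/
theorem CornishEtAl2020_cor_2_2_general [CompleteSpace Z] [SecondCountableTopology Z]
    [ProperSpace X] (P_Z : ProbabilityMeasure Z) (P₀ : ProbabilityMeasure X)
    (hsupp : IsEmpty ((P_Z : Measure Z).support ≃ₜ (P₀ : Measure X).support))
    (ρ : ProbabilityMeasure X → ProbabilityMeasure X → ℝ) (hρ0 : ∀ P Q, 0 ≤ ρ P Q)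
    (hρt : ∀ P Q R, ρ P R ≤ ρ P Q + ρ Q R)
    (hρw : ∀ (s : ℕ → ProbabilityMeasure X) (P : ProbabilityMeasure X),
      Tendsto (fun n => ρ (s n) P) atTop (𝓝 0) → Tendsto s atTop (𝓝 P)) :
    ∃ L : ℝ → ℝ≥0∞, Antitone L ∧ Tendsto L (𝓝[>] 0) (𝓝 ⊤) ∧
      ∀ (ε : ℝ) (P_X : ProbabilityMeasure X) (f : Z → X) (hf : AEMeasurable f (P_Z : Measure Z))
        (M : ℝ≥0), ρ P_X P₀ ≤ ε → ρ (P_Z.map hf) P_X ≤ ε →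
        LipschitzWith M f → AntilipschitzWith M f → L ε ≤ M := by
  -- admissibility of a constant `M` at level `ε`
  let A : ℝ → ℝ≥0 → Prop := fun ε M => ∃ (P_X : ProbabilityMeasure X) (f : Z → X)
    (hf : AEMeasurable f (P_Z : Measure Z)), ρ P_X P₀ ≤ ε ∧ ρ (P_Z.map hf) P_X ≤ ε ∧
      LipschitzWith M f ∧ AntilipschitzWith M f
  refine ⟨fun ε => ⨅ (M : ℝ≥0) (_ : A ε M), (M : ℝ≥0∞), ?_, ?_, ?_⟩
  · -- antitone: more room, more admissible constants
    intro ε ε' hle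
    refine le_iInf₂ fun M hM => iInf₂_le M ?_
    obtain ⟨P_X, f, hf, h1, h2, h3, h4⟩ := hM
    exact ⟨P_X, f, hf, h1.trans hle, h2.trans hle, h3, h4⟩
  · -- `L → ∞` as `ε → 0⁺`
    rw [ENNReal.tendsto_nhds_top_iff_nnreal]
    intro x
    obtain ⟨ε₀, hε₀, hno⟩ := CornishEtAl2020_cor_2_2_eps P_Z P₀ hsupp ρ hρ0 hρt hρw (x + 1)
    rw [eventually_nhdsWithin_iff]
    filter_upwards [eventually_lt_nhds hε₀] with ε hlt _hpos
    refine lt_of_lt_of_le (b := ((x + 1 : ℝ≥0) : ℝ≥0∞)) (by exact_mod_cast lt_add_one x)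
      (le_iInf₂ fun M hM => ?_)
    obtain ⟨P_X, f, hf, h1, h2, h3, h4⟩ := hM
    -- an admissible `M ≤ x + 1` would make `f` `(x+1)`-bi-Lipschitz at level `ε₀`
    by_contra hlt'
    have hMle : M ≤ x + 1 := by exact_mod_cast (not_le.1 hlt').le
    refine hno P_X f hf (h1.trans hlt.le) (h2.trans hlt.le) ⟨h3.weaken hMle, ?_⟩
    exact AntilipschitzWith.of_le_mul_dist fun a b => (h4.le_mul_dist a b).trans
      (mul_le_mul_of_nonneg_right (NNReal.coe_le_coe.2 hMle) dist_nonneg)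
  · intro ε P_X f hf M h1 h2 h3 h4
    exact iInf₂_le M ⟨P_X, f, hf, h1, h2, h3, h4⟩

end Main

/-! ## Theorem 2.1 as printed: `ℝ^{d_𝒵} → ℝ^{d_𝒳}`, Mathlib's topology of weak convergence -/

section Euclidean

/-- **Theorem 2.1 (Cornish–Caterini–Deligiannidis–Doucet 2020)** [cite: CornishEtAl2020, Thm 2.1],
as printed: "Suppose `P_Z` and `P_X⋆` are probability measures on `ℝ^{d_𝒵}` and `ℝ^{d_𝒳}`
respectively, and that `supp P_Z ≇ supp P_X⋆`.  Then for any sequence of measurable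
`f_n : ℝ^{d_𝒵} → ℝ^{d_𝒳}`, we can have `f_n # P_Z ⇒ P_X⋆` only if `lim_{n → ∞} BiLip f_n = ∞`."
Here `⇒` is weak convergence — convergence in Mathlib's topology on `ProbabilityMeasure`, of the
pushforwards `P_Z.map` — and the conclusion says that for every `M` eventually no `f_n` admits `M`
as both a Lipschitz and an antilipschitz constant. -/
theorem CornishEtAl2020_thm_2_1 (dZ dX : ℕ)
    (P_Z : ProbabilityMeasure (EuclideanSpace ℝ (Fin dZ)))
    (P_X : ProbabilityMeasure (EuclideanSpace ℝ (Fin dX)))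
    (hsupp : IsEmpty ((P_Z : Measure (EuclideanSpace ℝ (Fin dZ))).support ≃ₜ
      (P_X : Measure (EuclideanSpace ℝ (Fin dX))).support))
    (f : ℕ → EuclideanSpace ℝ (Fin dZ) → EuclideanSpace ℝ (Fin dX))
    (hfm : ∀ n, AEMeasurable (f n) (P_Z : Measure (EuclideanSpace ℝ (Fin dZ))))
    (hconv : Tendsto (fun n => P_Z.map (hfm n)) atTop (𝓝 P_X)) :
    ∀ M : ℝ≥0, ∀ᶠ n in atTop, ¬ (LipschitzWith M (f n) ∧ AntilipschitzWith M (f n)) := by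
  intro M
  have hint : ∀ h : EuclideanSpace ℝ (Fin dX) →ᵇ ℝ,
      Tendsto (fun n => ∫ z, h (f n z) ∂(P_Z : Measure (EuclideanSpace ℝ (Fin dZ)))) atTop
        (𝓝 (∫ x, h x ∂(P_X : Measure (EuclideanSpace ℝ (Fin dX))))) := by
    intro h
    have := (ProbabilityMeasure.tendsto_iff_forall_integral_tendsto.1 hconv) h
    refine this.congr' (Eventually.of_forall fun n => ?_)
    rw [ProbabilityMeasure.toMeasure_map, integral_map (hfm n) h.continuous.aestronglyMeasurable]
  exact eventually_not_biLipschitz_of_tendsto hsupp hint M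


/-- **Corollary 2.2 (Cornish–Caterini–Deligiannidis–Doucet 2020)** [cite: CornishEtAl2020,
Cor. 2.2], as printed on `ℝ^{d_𝒵} → ℝ^{d_𝒳}`: "Suppose `P_Z` and `P⁰_X` are probability measures on
`ℝ^{d_𝒵}` and `ℝ^{d_𝒳}` respectively with `supp P_Z ≇ supp P⁰_X`.  Then there exists nonincreasing
`L : [0, ∞) → [1, ∞]` with `L(ε) → ∞` as `ε → 0` such that, for any probability measure `P_X⋆` on
`ℝ^{d_𝒳}`, we have `BiLip f ≥ L(ε)` whenever `ρ(P_X⋆, P⁰_X) ≤ ε` and `ρ(f # P_Z, P_X⋆) ≤ ε`"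
(`ρ` "any metric for the weak topology": nonnegative, triangle inequality, `ρ(P_n, P) → 0 ⇒
P_n ⇒ P`). -/
theorem CornishEtAl2020_cor_2_2 (dZ dX : ℕ)
    (P_Z : ProbabilityMeasure (EuclideanSpace ℝ (Fin dZ)))
    (P₀ : ProbabilityMeasure (EuclideanSpace ℝ (Fin dX)))
    (hsupp : IsEmpty ((P_Z : Measure (EuclideanSpace ℝ (Fin dZ))).support ≃ₜ
      (P₀ : Measure (EuclideanSpace ℝ (Fin dX))).support))
    (ρ : ProbabilityMeasure (EuclideanSpace ℝ (Fin dX)) →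
      ProbabilityMeasure (EuclideanSpace ℝ (Fin dX)) → ℝ)
    (hρ0 : ∀ P Q, 0 ≤ ρ P Q) (hρt : ∀ P Q R, ρ P R ≤ ρ P Q + ρ Q R)
    (hρw : ∀ (s : ℕ → ProbabilityMeasure (EuclideanSpace ℝ (Fin dX)))
      (P : ProbabilityMeasure (EuclideanSpace ℝ (Fin dX))),
      Tendsto (fun n => ρ (s n) P) atTop (𝓝 0) → Tendsto s atTop (𝓝 P)) :
    ∃ L : ℝ → ℝ≥0∞, Antitone L ∧ Tendsto L (𝓝[>] 0) (𝓝 ⊤) ∧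
      ∀ (ε : ℝ) (P_X : ProbabilityMeasure (EuclideanSpace ℝ (Fin dX)))
        (f : EuclideanSpace ℝ (Fin dZ) → EuclideanSpace ℝ (Fin dX))
        (hf : AEMeasurable f (P_Z : Measure (EuclideanSpace ℝ (Fin dZ)))) (M : ℝ≥0),
        ρ P_X P₀ ≤ ε → ρ (P_Z.map hf) P_X ≤ ε →
        LipschitzWith M f → AntilipschitzWith M f → L ε ≤ M :=
  CornishEtAl2020_cor_2_2_general P_Z P₀ hsupp ρ hρ0 hρt hρw

end Euclidean

end Literature.Probability.TransportMaps
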